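import Mathlib.Analysis.Convex.Cone.Extension
import Mathlib.MeasureTheory.Integral.RieszMarkovKakutani.Real
import Mathlib.Analysis.Calculus.BumpFunction.Normed
import Literature.NumberTheory.LFunctions.WeilWindowSimpleEven
import HarnessLib

/-!
# Kreĭn–M. Riesz extension of the Weil functional on a window to a positive functional on `C_c(ℝ)`

Topic `Literature/NumberTheory/LFunctions` (normalisation of `WeilExplicit.lean`: tests `IsWeilTest`,
transform `ĝ(s) = weilMellin g s`, functional `W = weilFunctional`, squares `weilConv g (weilReflect g)`).
Everything here is PROVED; there are no definitions and no named facts.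

This is the functional-analytic core of the Bochner–Kreĭn representation of `W` on a window
(`WeilBochnerRepresentation*.lean`): M. G. Kreĭn's extension of a positive definite function given on an
interval (1940), run in M. Riesz's form (Mathlib `riesz_extension`) for the Weil functional.  Fix `R > 0`
and suppose `W` is NONNEGATIVE ON THE CONE OF NONNEGATIVE TRANSFORMS of the window:
`Re W(k) ≥ 0` for every test `k` supported in `[-R, R]` with `Re k̂(½+it) ≥ 0` for all real `t`
(hypothesis `hN`; it is supplied from Weil positivity on half the window by the Boas–Kac/Kreĭn
factorisation `k = φ ⋆ φ̃`, `re_weilFunctional_nonneg_of_factor`).  On `E = K × C_c(ℝ, ℝ)`, `K` the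
real vector space of tests supported in `[-R, R]`, with the "evaluation" `ev(k, c)(t) = Re k̂(½+it) + c(t)`
and the cone `s = {ev ≥ 0 pointwise}`, the functional `(k, 0) ↦ Re W(k)` is nonnegative on `s` and its
domain is cofinal (`exists_sq_dominating`: a thin bump square `φ ⋆ φ̃` has `|φ̂(½+it)|² ≥ (cos 1 ∫φ)² > 0`
on any prescribed compact set), so it extends to `G ≥ 0` on `s`; `Λ c := G(0, c)` is then a positive
linear functional on `C_c(ℝ, ℝ)` with

  `Re W(k) + Λ c ≥ 0` whenever `Re k̂(½+it) + c(t) ≥ 0` for all `t`          (`exists_positive_extension`).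

The Riesz–Markov–Kakutani measure of `Λ` and the identification `W(g) = ∫ ĝ(½+it) dμ` are in
`WeilBochnerRepresentation*.lean`.  Also here: `Re W(k̃) = Re W(k)` with no hypotheses, and the hermitian
symmetrisation reducing nonnegativity on the cone to squares (`re_weilFunctional_nonneg_of_factor`).

## References

* M. G. Kreĭn, *Sur le problème du prolongement des fonctions hermitiennes positives et continues*,
  C. R. (Doklady) Acad. Sci. URSS 26 (1940), 17–22 [cite: Krein1940]; M. Riesz, *Sur le problème des
  moments, III*, Ark. Mat. Astr. Fys. 17 (1923) (the extension theorem; Mathlib `riesz_extension`).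
* E. Bombieri, *Remarks on Weil's quadratic functional …*, Rend. Mat. Acc. Lincei (9) 11 (2000), §§2–4.
-/

noncomputable section

open Complex Filter Set MeasureTheory CompactlySupported
open scoped Real Topology ContDiff ComplexConjugate

namespace Literature.NumberTheory.LFunctions

namespace WeilBochner

variable {k k₁ k₂ : ℝ → ℂ}

/-! ## Test-function bookkeeping over `ℝ` -/

/-- A real multiple of a complex function, pointwise. [folklore] -/
theorem smul_real_eq (c : ℝ) (k : ℝ → ℂ) : c • k = fun t => (c : ℂ) * k t := by
  funext t
  simp [Complex.real_smul]

/-- Real multiples of tests are tests. [folklore] -/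
theorem isWeilTest_smul_real (hk : IsWeilTest k) (c : ℝ) : IsWeilTest (c • k) := by
  rw [smul_real_eq]
  exact hk.const_mul _

/-- Real multiples do not enlarge the support. [folklore] -/
theorem tsupport_smul_real_subset (c : ℝ) (k : ℝ → ℂ) : tsupport (c • k) ⊆ tsupport k := by
  rw [smul_real_eq]
  exact tsupport_mul_subset_right

/-- `(c k)^(s) = c k̂(s)` for real `c`. [folklore] -/
theorem weilMellin_smul_real (c : ℝ) (k : ℝ → ℂ) (s : ℂ) :
    weilMellin (c • k) s = (c : ℂ) * weilMellin k s := by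
  rw [smul_real_eq, weilMellin_const_mul]

/-- `W(c k) = c W(k)` for real `c`. [folklore] -/
theorem weilFunctional_smul_real (c : ℝ) (k : ℝ → ℂ) :
    weilFunctional (c • k) = (c : ℂ) * weilFunctional k := by
  rw [smul_real_eq, weilFunctional_const_mul]

/-! ## `Re W(k̃) = Re W(k)` -/

/-- **Conjugation and the involution**: `conj W(k) = W(k̃)` for every `k : ℝ → ℂ`, hence
`Re W(k̃) = Re W(k)` (each of the three terms: `(k̃)^(s) = conj k̂(1 - conj s)` swaps `k̂(0), k̂(1)`; the
prime summands and the archimedean integrand are conjugated; no hypotheses, both sides carrying the same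
junk values; compare `conj_weilFunctional_of_selfAdjoint`, Bombieri 2000 §§2–3). [cite: Bombieri2000Weil, §§2–3] -/
theorem re_weilFunctional_weilReflect (k : ℝ → ℂ) :
    (weilFunctional (weilReflect k)).re = (weilFunctional k).re := by
  have hM : ∀ s, weilMellin (weilReflect k) s = conj (weilMellin k (1 - conj s)) :=
    weilMellin_weilReflect_holds k
  have hhalf : ∀ t : ℝ, (1 : ℂ) - conj (1 / 2 + (t : ℂ) * I) = 1 / 2 + (t : ℂ) * I := fun t ↦ by
    apply Complex.ext <;> (simp; try norm_num)
  have hP : conj (weilPolarTerm k) = weilPolarTerm (weilReflect k) := by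
    rw [weilPolarTerm, weilPolarTerm, map_add, hM, hM, map_one, map_zero, sub_zero, sub_self, add_comm]
  have hΛ : conj (weilPrimeTerm k) = weilPrimeTerm (weilReflect k) := by
    rw [weilPrimeTerm, weilPrimeTerm, Complex.conj_tsum]
    refine tsum_congr fun n ↦ ?_
    simp only [weilReflect, neg_neg, map_mul, map_div₀, Complex.conj_ofReal, map_add]
    ring
  have hA : conj (weilArchTerm k) = weilArchTerm (weilReflect k) := by
    have h0 : weilReflect k 0 = conj (k 0) := by simp [weilReflect]
    rw [weilArchTerm, weilArchTerm, map_sub, map_mul, map_mul, Complex.conj_ofReal, weilArchIntegral,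
      weilArchIntegral, ← integral_conj, h0]
    congr 2
    · rw [map_div₀, map_one, map_mul, map_ofNat, Complex.conj_ofReal]
    · refine integral_congr_ae (Eventually.of_forall fun t ↦ ?_)
      dsimp only
      rw [map_mul, Complex.conj_ofReal, hM, hhalf t]
  have hconj : conj (weilFunctional k) = weilFunctional (weilReflect k) := by
    rw [weilFunctional, weilFunctional, map_add, map_sub, hP, hΛ, hA]
  rw [← hconj, Complex.conj_re]

/-- On the critical line `(k̃)^(½+it) = conj k̂(½+it)`. [folklore] -/
theorem weilMellin_weilReflect_half (k : ℝ → ℂ) (t : ℝ) :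
    weilMellin (weilReflect k) (1 / 2 + t * I) = conj (weilMellin k (1 / 2 + t * I)) := by
  rw [weilMellin_weilReflect_holds]
  congr 2
  apply Complex.ext <;> (simp; try norm_num)

/-! ## From squares to the cone of nonnegative transforms (hermitian symmetrisation) -/

/-- **Nonnegativity of `W` on the cone of nonnegative transforms, from Weil positivity and a
factorisation of positive definite tests.**  If every test `k` supported in `[-R, R]` whose transform
on the critical line is a nonnegative real is a square `φ ⋆ φ̃` with `tsupport φ ⊆ [-a, a]`, and
`WeilPositivityOn a` holds, then `Re W(k) ≥ 0` for every test `k` supported in `[-R, R]` with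
`Re k̂(½+it) ≥ 0` for all `t` (apply the hypotheses to `k_H = (k + k̃)/2`, whose transform on the line
is `Re k̂ ≥ 0` and whose value `Re W(k_H)` equals `Re W(k)` by `conj W(k) = W(k̃)`).
[cite: Krein1940] -/
theorem re_weilFunctional_nonneg_of_factor {R a : ℝ} (hpos : WeilPositivityOn a)
    (hfac : ∀ k : ℝ → ℂ, IsWeilTest k → tsupport k ⊆ Icc (-R) R →
      (∀ t : ℝ, 0 ≤ (weilMellin k (1 / 2 + t * I)).re ∧ (weilMellin k (1 / 2 + t * I)).im = 0) →
      ∃ φ : ℝ → ℂ, IsWeilTest φ ∧ tsupport φ ⊆ Icc (-a) a ∧ weilConv φ (weilReflect φ) = k)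
    {k : ℝ → ℂ} (hk : IsWeilTest k) (hks : tsupport k ⊆ Icc (-R) R)
    (hre : ∀ t : ℝ, 0 ≤ (weilMellin k (1 / 2 + t * I)).re) : 0 ≤ (weilFunctional k).re := by
  set kH : ℝ → ℂ := fun t ↦ (1 / 2 : ℂ) * (k + weilReflect k) t with hkH
  have hkr : IsWeilTest (weilReflect k) := hk.weilReflect
  have hkH_test : IsWeilTest kH := (hk.add hkr).const_mul _
  have hkH_supp : tsupport kH ⊆ Icc (-R) R := by
    refine tsupport_mul_subset_right.trans ((tsupport_add k (weilReflect k)).trans (union_subset hks ?_))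
    rw [tsupport_weilReflect]
    intro x hx
    have := hks hx
    simp only [mem_Icc] at this ⊢
    constructor <;> linarith [this.1, this.2]
  have hkH_mellin : ∀ t : ℝ, weilMellin kH (1 / 2 + t * I) = ((weilMellin k (1 / 2 + t * I)).re : ℂ) := by
    intro t
    rw [hkH, weilMellin_const_mul, weilMellin_add hk.1.continuous hk.2 hkr.1.continuous hkr.2,
      weilMellin_weilReflect_half, Complex.add_conj]
    push_cast
    ring
  obtain ⟨φ, hφ, hφs, hφk⟩ := hfac kH hkH_test hkH_supp fun t ↦ by
    rw [hkH_mellin t]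
    exact ⟨by simpa using hre t, by simp⟩
  have hQ : 0 ≤ (weilFunctional kH).re := by
    have := hpos φ hφ hφs
    rwa [weilQuadratic, hφk] at this
  have hW : (weilFunctional kH).re = (weilFunctional k).re := by
    rw [hkH, weilFunctional_const_mul, weilFunctional_add hk hkr, Complex.mul_re, add_re, add_im,
      re_weilFunctional_weilReflect]
    norm_num
    ring
  rwa [hW] at hQ

/-! ## Thin bump squares and their transforms -/

/-- The complexified bump `t ↦ b(t)` is a Weil test. [folklore] -/
theorem isWeilTest_bump (b : ContDiffBump (0 : ℝ)) : IsWeilTest (fun t ↦ ((b t : ℝ) : ℂ)) :=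
  ⟨Complex.ofRealCLM.contDiff.comp b.contDiff, b.hasCompactSupport.comp_left Complex.ofReal_zero⟩

/-- Its support is `[-r_out, r_out]`. [folklore] -/
theorem tsupport_bump_subset (b : ContDiffBump (0 : ℝ)) :
    tsupport (fun t ↦ ((b t : ℝ) : ℂ)) ⊆ Icc (-b.rOut) b.rOut := by
  refine (tsupport_comp_subset Complex.ofReal_zero _).trans ?_
  rw [b.tsupport_eq, Real.closedBall_eq_Icc, zero_sub, zero_add]

/-- Lower bound for the transform of a nonnegative bump at low frequencies: if `|γ| r_out ≤ 1` then
`Re b̂(½+iγ) ≥ cos 1 · ∫ b` (`cos(γt) ≥ cos 1` on the support). [folklore] -/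
theorem re_weilMellin_bump_ge (b : ContDiffBump (0 : ℝ)) {γ : ℝ} (hγ : |γ| * b.rOut ≤ 1) :
    Real.cos 1 * ∫ t, b t ≤ (weilMellin (fun t ↦ ((b t : ℝ) : ℂ)) (1 / 2 + (γ : ℂ) * I)).re := by
  -- adapted from `Summit.…WindowTracePrime2.Negative.re_weilMellin_bump_ge` (FiniteFamilies.lean)
  have hexp : ∀ t : ℝ, (1 / 2 + (γ : ℂ) * I - 1 / 2) * (t : ℂ) = ((γ * t : ℝ) : ℂ) * I :=
    fun t ↦ by push_cast; ring
  have hint : Integrable fun t : ℝ ↦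
      ((b t : ℝ) : ℂ) * cexp ((1 / 2 + (γ : ℂ) * I - 1 / 2) * (t : ℂ)) := by
    refine Continuous.integrable_of_hasCompactSupport ?_ ?_
    · exact (Complex.continuous_ofReal.comp b.continuous).mul (by fun_prop)
    · exact (b.hasCompactSupport.comp_left Complex.ofReal_zero).mul_right
  have hre : ∀ t : ℝ, (((b t : ℝ) : ℂ) * cexp ((1 / 2 + (γ : ℂ) * I - 1 / 2) * (t : ℂ))).re =
      b t * Real.cos (γ * t) := by
    intro t
    rw [hexp, Complex.re_ofReal_mul, Complex.exp_ofReal_mul_I_re]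
  unfold weilMellin
  rw [← RCLike.re_to_complex, ← integral_re hint]
  simp only [RCLike.re_to_complex, hre]
  rw [← integral_const_mul]
  refine integral_mono ?_ ?_ fun t ↦ ?_
  · exact (b.continuous.const_mul _).integrable_of_hasCompactSupport b.hasCompactSupport.mul_left
  · exact (b.continuous.mul (by fun_prop)).integrable_of_hasCompactSupport
      b.hasCompactSupport.mul_right
  · show Real.cos 1 * b t ≤ b t * Real.cos (γ * t)
    by_cases ht : t ∈ tsupport b
    · rw [b.tsupport_eq, Metric.mem_closedBall, dist_zero_right, Real.norm_eq_abs] at ht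
      have h1 : |γ * t| ≤ 1 := by
        rw [abs_mul]
        calc |γ| * |t| ≤ |γ| * b.rOut := by gcongr
          _ ≤ 1 := hγ
      have hcos : Real.cos 1 ≤ Real.cos (γ * t) := by
        rw [← Real.cos_abs (γ * t)]
        exact Real.cos_le_cos_of_nonneg_of_le_pi (abs_nonneg _) (by linarith [Real.pi_gt_three]) h1
      nlinarith [b.nonneg (x := t)]
    · rw [image_eq_zero_of_notMem_tsupport ht]
      simp

/-- On the critical line the transform of the bump square `φ ⋆ φ̃` is `‖φ̂(½+it)‖²`. [folklore] -/
theorem re_weilMellin_bumpSq (b : ContDiffBump (0 : ℝ)) (t : ℝ) :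
    (weilMellin (weilConv (fun t ↦ ((b t : ℝ) : ℂ)) (weilReflect fun t ↦ ((b t : ℝ) : ℂ)))
        (1 / 2 + t * I)).re = ‖weilMellin (fun t ↦ ((b t : ℝ) : ℂ)) (1 / 2 + t * I)‖ ^ 2 := by
  rw [weilMellin_weilQuadratic_of_re_eq (isWeilTest_bump b) (by simp), Complex.ofReal_re,
    Complex.normSq_eq_norm_sq]

/-- … and it is at least `(cos 1 ∫ b)²` at the frequencies `|t| r_out ≤ 1`. [folklore] -/
theorem sq_le_re_weilMellin_bumpSq (b : ContDiffBump (0 : ℝ)) {t : ℝ} (ht : |t| * b.rOut ≤ 1) :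
    (Real.cos 1 * ∫ x, b x) ^ 2 ≤
      (weilMellin (weilConv (fun t ↦ ((b t : ℝ) : ℂ)) (weilReflect fun t ↦ ((b t : ℝ) : ℂ)))
        (1 / 2 + t * I)).re := by
  rw [re_weilMellin_bumpSq]
  have hcos : 0 < Real.cos 1 := Real.cos_pos_of_mem_Ioo ⟨by linarith [Real.pi_gt_three],
    by linarith [Real.pi_gt_three]⟩
  have h0 : 0 ≤ Real.cos 1 * ∫ x, b x := mul_nonneg hcos.le (integral_nonneg fun x ↦ b.nonneg)
  have h := re_weilMellin_bump_ge b ht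
  exact pow_le_pow_left₀ h0 (h.trans (Complex.re_le_norm _)) 2

/-- **Cofinality of the squares.**  For `R > 0` and `c ∈ C_c(ℝ, ℝ)` there are a test `k` supported in
`[-R, R]` with `Re k̂(½+it) ≥ 0` for all `t`, and `M` with `M Re k̂(½+it) + c(t) ≥ 0` for all `t`:
`k = φ ⋆ φ̃` for a bump `φ` of radius `≤ min (R/2) (1/(S+1))`, `supp c ⊆ [-S, S]`, so that
`Re k̂ = |φ̂|² ≥ (cos 1 ∫φ)²` on `supp c`. [cite: Krein1940] -/
theorem exists_sq_dominating {R : ℝ} (hR : 0 < R) (c : C_c(ℝ, ℝ)) :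
    ∃ k : ℝ → ℂ, IsWeilTest k ∧ tsupport k ⊆ Icc (-R) R ∧
      (∀ t : ℝ, 0 ≤ (weilMellin k (1 / 2 + t * I)).re) ∧
      ∃ M : ℝ, ∀ t : ℝ, 0 ≤ M * (weilMellin k (1 / 2 + t * I)).re + c t := by
  obtain ⟨S, hS⟩ := c.hasCompactSupport.isCompact.isBounded.subset_closedBall 0
  obtain ⟨B, hB⟩ : ∃ B : ℝ, ∀ x : ℝ, ‖c x‖ ≤ B :=
    c.continuous.bounded_above_of_compact_support c.hasCompactSupport
  have hB0 : 0 ≤ B := (norm_nonneg _).trans (hB 0)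
  set r : ℝ := min (R / 2) (1 / (|S| + 1)) with hr_def
  have hr : 0 < r := lt_min (by positivity) (by positivity)
  have hrR : r ≤ R / 2 := min_le_left _ _
  have hrS : r ≤ 1 / (|S| + 1) := min_le_right _ _
  let b : ContDiffBump (0 : ℝ) := ⟨r / 2, r, by positivity, by linarith⟩
  have hφ := isWeilTest_bump b
  refine ⟨weilConv (fun t ↦ ((b t : ℝ) : ℂ)) (weilReflect fun t ↦ ((b t : ℝ) : ℂ)),
    hφ.weilConv hφ.weilReflect, ?_, fun t ↦ ?_, ?_⟩
  · refine (tsupport_weilConv_weilReflect_subset hφ.2 (tsupport_bump_subset b)).trans ?_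
    show Icc (-(2 * r)) (2 * r) ⊆ Icc (-R) R
    exact Icc_subset_Icc (by linarith) (by linarith)
  · rw [re_weilMellin_bumpSq]
    positivity
  · set c₀ : ℝ := Real.cos 1 * ∫ x, b x with hc₀
    have hc₀pos : 0 < c₀ := mul_pos (Real.cos_pos_of_mem_Ioo ⟨by linarith [Real.pi_gt_three],
      by linarith [Real.pi_gt_three]⟩) b.integral_pos
    refine ⟨B / c₀ ^ 2, fun t ↦ ?_⟩
    by_cases ht : |t| ≤ |S|
    · have hγ : |t| * b.rOut ≤ 1 := by
        show |t| * r ≤ 1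
        calc |t| * r ≤ |S| * (1 / (|S| + 1)) :=
              mul_le_mul ht hrS hr.le (abs_nonneg _)
          _ ≤ 1 := by rw [mul_one_div, div_le_one (by positivity)]; linarith
      have hle := sq_le_re_weilMellin_bumpSq b hγ
      have hct : -B ≤ c t := by
        have := hB t
        rw [Real.norm_eq_abs] at this
        linarith [neg_abs_le (c t)]
      have : B ≤ B / c₀ ^ 2 *
          (weilMellin (weilConv (fun t ↦ ((b t : ℝ) : ℂ)) (weilReflect fun t ↦ ((b t : ℝ) : ℂ)))
            (1 / 2 + t * I)).re := by
        rw [div_mul_eq_mul_div, le_div_iff₀ (by positivity)]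
        exact mul_le_mul_of_nonneg_left hle hB0
      linarith
    · have hct : c t = 0 := by
        refine image_eq_zero_of_notMem_tsupport fun h' ↦ ht ?_
        have := hS h'
        rw [Metric.mem_closedBall, dist_zero_right, Real.norm_eq_abs] at this
        exact this.trans (le_abs_self S)
      rw [hct, add_zero]
      refine mul_nonneg (div_nonneg hB0 (sq_nonneg _)) ?_
      rw [re_weilMellin_bumpSq]
      positivity

/-! ## The extension -/

/-- **Kreĭn–M. Riesz extension of the Weil functional on a window.**  Let `R > 0` and suppose
`Re W(k) ≥ 0` for every test `k` supported in `[-R, R]` whose transform has `Re k̂(½+it) ≥ 0` for all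
real `t`.  Then there is a POSITIVE linear functional `Λ` on `C_c(ℝ, ℝ)` such that
`Re W(k) + Λ c ≥ 0` whenever `k` is a test supported in `[-R, R]`, `c ∈ C_c(ℝ, ℝ)` and
`Re k̂(½+it) + c(t) ≥ 0` for all `t` (M. Riesz's extension theorem on `K × C_c(ℝ, ℝ)` for the cone of
pointwise nonnegative `Re k̂ + c`, the domain `K × 0` being cofinal by `exists_sq_dominating`).
[cite: Krein1940] -/
theorem exists_positive_extension {R : ℝ} (hR : 0 < R)
    (hN : ∀ k : ℝ → ℂ, IsWeilTest k → tsupport k ⊆ Icc (-R) R →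
      (∀ t : ℝ, 0 ≤ (weilMellin k (1 / 2 + t * I)).re) → 0 ≤ (weilFunctional k).re) :
    ∃ Λ : C_c(ℝ, ℝ) →ₚ[ℝ] ℝ, ∀ k : ℝ → ℂ, IsWeilTest k → tsupport k ⊆ Icc (-R) R →
      ∀ c : C_c(ℝ, ℝ), (∀ t : ℝ, 0 ≤ (weilMellin k (1 / 2 + t * I)).re + c t) →
        0 ≤ (weilFunctional k).re + Λ c := by
  classical
  -- the real vector space of tests supported in `[-R, R]`
  let K : Submodule ℝ (ℝ → ℂ) :=
    { carrier := {k | IsWeilTest k ∧ tsupport k ⊆ Icc (-R) R}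
      add_mem' := fun {k₁ k₂} hk₁ hk₂ ↦
        ⟨hk₁.1.add hk₂.1, (tsupport_add k₁ k₂).trans (union_subset hk₁.2 hk₂.2)⟩
      zero_mem' := ⟨⟨contDiff_const, HasCompactSupport.zero⟩, by simp⟩
      smul_mem' := fun c k hk ↦ ⟨isWeilTest_smul_real hk.1 c, (tsupport_smul_real_subset c k).trans hk.2⟩ }
  have hKmem : ∀ {k : ℝ → ℂ}, k ∈ K ↔ IsWeilTest k ∧ tsupport k ⊆ Icc (-R) R := Iff.rfl
  -- `Φ k = Re k̂(½+i·)` and `W k = Re W(k)`, real-linear on `K`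
  let Φ : K →ₗ[ℝ] (ℝ → ℝ) :=
    { toFun := fun k t ↦ (weilMellin (k : ℝ → ℂ) (1 / 2 + t * I)).re
      map_add' := fun k₁ k₂ ↦ by
        funext t
        have h₁ := (hKmem.1 k₁.2).1
        have h₂ := (hKmem.1 k₂.2).1
        simp only [Submodule.coe_add, Pi.add_apply]
        rw [weilMellin_add h₁.1.continuous h₁.2 h₂.1.continuous h₂.2, add_re]
      map_smul' := fun c k ↦ by
        funext t
        simp only [Submodule.coe_smul, Pi.smul_apply, RingHom.id_apply, smul_eq_mul]
        rw [weilMellin_smul_real, Complex.re_ofReal_mul] }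
  let W : K →ₗ[ℝ] ℝ :=
    { toFun := fun k ↦ (weilFunctional (k : ℝ → ℂ)).re
      map_add' := fun k₁ k₂ ↦ by
        have h₁ := (hKmem.1 k₁.2).1
        have h₂ := (hKmem.1 k₂.2).1
        simp only [Submodule.coe_add]
        rw [weilFunctional_add h₁ h₂, add_re]
      map_smul' := fun c k ↦ by
        simp only [Submodule.coe_smul, RingHom.id_apply, smul_eq_mul]
        rw [weilFunctional_smul_real, Complex.re_ofReal_mul] }
  let coeL : C_c(ℝ, ℝ) →ₗ[ℝ] (ℝ → ℝ) :=
    { toFun := fun f ↦ (f : ℝ → ℝ)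
      map_add' := fun f g ↦ CompactlySupportedContinuousMap.coe_add f g
      map_smul' := fun c f ↦ CompactlySupportedContinuousMap.coe_smul c f }
  let ev : (K × C_c(ℝ, ℝ)) →ₗ[ℝ] (ℝ → ℝ) := Φ.coprod coeL
  let s : PointedCone ℝ (K × C_c(ℝ, ℝ)) := (PointedCone.positive ℝ (ℝ → ℝ)).comap ev
  have hs : ∀ x : K × C_c(ℝ, ℝ),
      x ∈ s ↔ ∀ t : ℝ, 0 ≤ (weilMellin (x.1 : ℝ → ℂ) (1 / 2 + t * I)).re + x.2 t := fun x ↦ Iff.rfl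
  let D : Submodule ℝ (K × C_c(ℝ, ℝ)) := Submodule.prod ⊤ ⊥
  let fP : (K × C_c(ℝ, ℝ)) →ₗ.[ℝ] ℝ := ⟨D, W.comp ((LinearMap.fst ℝ K (C_c(ℝ, ℝ))).comp D.subtype)⟩
  have hfP : ∀ x : fP.domain, fP x = (weilFunctional ((x : K × C_c(ℝ, ℝ)).1 : ℝ → ℂ)).re :=
    fun x ↦ rfl
  -- `nonneg`: on the domain `K × 0` the cone condition is `Re k̂ ≥ 0`, and then `Re W(k) ≥ 0`
  have hnonneg : ∀ x : fP.domain, (x : K × C_c(ℝ, ℝ)) ∈ s → 0 ≤ fP x := by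
    intro x hx
    have hx2 : ((x : K × C_c(ℝ, ℝ))).2 = 0 := (Submodule.mem_bot ℝ).1 (Submodule.mem_prod.1 x.2).2
    have hk := hKmem.1 ((x : K × C_c(ℝ, ℝ))).1.2
    rw [hfP]
    refine hN _ hk.1 hk.2 fun t ↦ ?_
    have := (hs _).1 hx t
    simpa [hx2] using this
  -- `dense`: `K × 0` is cofinal (thin bump squares dominate any `c ∈ C_c`)
  have hdense : ∀ y : K × C_c(ℝ, ℝ), ∃ x : fP.domain, (x : K × C_c(ℝ, ℝ)) + y ∈ s := by
    rintro ⟨k₁, c⟩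
    obtain ⟨k₀, hk₀, hk₀s, -, M, hM⟩ := exists_sq_dominating hR c
    set k₀K : K := ⟨k₀, hKmem.2 ⟨hk₀, hk₀s⟩⟩ with hk₀K
    have hxD : ((M • k₀K - k₁, (0 : C_c(ℝ, ℝ))) : K × C_c(ℝ, ℝ)) ∈ D :=
      Submodule.mem_prod.2 ⟨Submodule.mem_top, Submodule.zero_mem _⟩
    refine ⟨⟨(M • k₀K - k₁, 0), hxD⟩, ?_⟩
    show ((M • k₀K - k₁, (0 : C_c(ℝ, ℝ))) : K × C_c(ℝ, ℝ)) + (k₁, c) ∈ s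
    rw [Prod.mk_add_mk, sub_add_cancel, zero_add]
    refine (hs _).2 fun t ↦ ?_
    simp only [Submodule.coe_smul]
    rw [weilMellin_smul_real, Complex.re_ofReal_mul]
    exact hM t
  obtain ⟨G, hGf, hGs⟩ := riesz_extension s fP hnonneg hdense
  -- the positive functional `Λ c = G (0, c)`
  let Λl : C_c(ℝ, ℝ) →ₗ[ℝ] ℝ := G.comp (LinearMap.inr ℝ K (C_c(ℝ, ℝ)))
  have hΛl : ∀ c, Λl c = G (0, c) := fun c ↦ rfl
  have hΛpos : ∀ c : C_c(ℝ, ℝ), 0 ≤ c → 0 ≤ Λl c := by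
    intro c hc
    rw [hΛl]
    refine hGs _ ((hs _).2 fun t ↦ ?_)
    have hct : 0 ≤ c t := by
      have := (CompactlySupportedContinuousMap.le_def.1 hc) t
      simpa using this
    simpa [weilMellin] using hct
  refine ⟨PositiveLinearMap.mk₀ Λl hΛpos, fun k hk hks c hc ↦ ?_⟩
  set kK : K := ⟨k, hKmem.2 ⟨hk, hks⟩⟩ with hkK
  have hmem : ((kK, c) : K × C_c(ℝ, ℝ)) ∈ s := (hs _).2 hc
  have h0 := hGs _ hmem
  have hsplit : G (kK, c) = G (kK, 0) + G (0, c) := by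
    rw [← map_add, Prod.mk_add_mk, add_zero, zero_add]
  have hx₀ : ((kK, (0 : C_c(ℝ, ℝ))) : K × C_c(ℝ, ℝ)) ∈ D :=
    Submodule.mem_prod.2 ⟨Submodule.mem_top, Submodule.zero_mem _⟩
  have hW : G (kK, 0) = (weilFunctional k).re := by rw [hGf ⟨(kK, 0), hx₀⟩, hfP]
  have hΛ : (PositiveLinearMap.mk₀ Λl hΛpos) c = G (0, c) := rfl
  linarith [h0, hsplit, hW, hΛ]

end WeilBochner

end Literature.NumberTheory.LFunctions

end
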